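import Mathlib
import HarnessLib

/-!
# The coefficient field `𝔽̄₃` (helper for item stmt-Langlands-13759, route PicardMuOrdinary)

`K3 = 𝔽̄₃` with the discrete topology (the coefficient field of the residual representation
`σ̄ : Γ_ℚ → GL₂(𝔽̄₃)` of the item `ResidualAutomorphyOdd`), the inclusion `castF3 : 𝔽₃ → 𝔽̄₃`, and
`2 ≠ 0`, `3 = 0`, `-1 ≠ 1` there.
-/

set_option linter.dupNamespace false -- project-wide option (lakefile weak.linter.dupNamespace); `Summit.Langlands.Langlands` is the mandated namespace

noncomputable section

open scoped MatrixGroups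

namespace Summit.Langlands.Langlands.Theorems.ResidualAutomorphyOdd

/-! ### The coefficient field `𝔽̄₃` (discrete) -/

/-- An algebraic closure of `𝔽₃`, carrying the discrete topology. -/
def K3 : Type := AlgebraicClosure (ZMod 3)

/-- `𝔽̄₃` is a field. -/
instance : Field K3 := inferInstanceAs (Field (AlgebraicClosure (ZMod 3)))

/-- `𝔽̄₃` is algebraically closed. -/
instance : IsAlgClosed K3 := inferInstanceAs (IsAlgClosed (AlgebraicClosure (ZMod 3)))

/-- `𝔽̄₃` has characteristic `3`. -/
instance : CharP K3 3 := inferInstanceAs (CharP (AlgebraicClosure (ZMod 3)) 3)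

/-- The discrete topology on `𝔽̄₃`. -/
instance : TopologicalSpace K3 := ⊥

/-- The topology on `𝔽̄₃` is discrete. -/
instance : DiscreteTopology K3 := ⟨rfl⟩

/-- `𝔽̄₃` is a topological ring. -/
instance : IsTopologicalRing K3 := inferInstance

/-- `(2 : 𝔽̄₃) ≠ 0`. -/
theorem two_ne_zero_K3 : (2 : K3) ≠ 0 := by
  intro h2
  have h3 : ((3 : ℕ) : K3) = 0 := CharP.cast_eq_zero K3 3
  have h1 : (1 : K3) = 0 := by
    have : ((3 : ℕ) : K3) = 2 + 1 := by norm_num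
    rw [this, h2, zero_add] at h3
    exact h3
  exact one_ne_zero h1

/-- `2 ≠ 0` in `𝔽̄₃`, as an instance. -/
instance : NeZero (2 : K3) := ⟨two_ne_zero_K3⟩

/-- The inclusion `𝔽₃ ↪ 𝔽̄₃`. -/
abbrev castF3 : ZMod 3 →+* K3 := ZMod.castHom (dvd_refl 3) K3

/-- `(-1 : 𝔽̄₃ˣ) ≠ 1`. -/
theorem neg_one_ne_one_K3 : (-1 : K3ˣ) ≠ 1 := by
  intro h
  have h' : ((-1 : K3ˣ) : K3) = ((1 : K3ˣ) : K3) := by rw [h]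
  rw [Units.val_neg, Units.val_one] at h'
  apply two_ne_zero_K3
  linear_combination -h'

/-- `3 = 0` in `𝔽̄₃`. -/
theorem three_eq_zero_K3 : (3 : K3) = 0 := by
  have := CharP.cast_eq_zero K3 3
  exact_mod_cast this

end Summit.Langlands.Langlands.Theorems.ResidualAutomorphyOdd
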